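import Summits.AtomisticToContinuum.Crystallization.Theorems.PricedLinkCensusTruncatedCensusGapDefectFarPeriodicBlocks
import Summits.AtomisticToContinuum.Crystallization.Theorems.PricedLinkCensusTruncatedCensusGapFarPeriodicForm

/-!
# The defect far-site gap (FAR₂) is EXACTLY a periodic defect-far-site pricing

Registered sub-goal `defectFarSiteGap_iff_periodicDefectFarPricing` (FAR₂-PERIODIC FORM, part
3 of 3) of the stub `stub_defectFarSiteGap` (FAR₂, the open core) of the line
`elastic-basin-split` (`Cruxes/TruncatedCensusGap/Lines/elastic_basin_split.lean`) of the crux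
`PricedLinkCensus.TruncatedCensusGap` (item stmt-AtomisticToContinuum-14230); the PORT to the
near₂ predicate of `farSiteGap_iff_periodicFarPricing` (`…FarPeriodicForm.lean`, line
`near-far-split`), itself the twin of `underCoordinationGap_iff_periodicUnderPricing` and of
`truncatedCensusGap_iff_periodicPricing` (`…CruxForms.lean`).  Notation as in part 2
(`…DefectFarPeriodicBlocks.lean`): `V_χ`, `e_χ*`, NEAR₂ sites (the predicate `∃ s F g, …` of
the stub, spelled out in every statement: Hägg word `s`, linear strain `F` with
`‖F v - a₀ • v‖ ≤ (a₀/10) ‖v‖`, rigid motion `g`, the `a₀/2`-separated closed `3a₀`-patch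
two-way `a₀/8`-matched to the reference points `g (F z)`, `z ∈ barlowStacking 1 √(2/3) s`,
`a₀ = 977/1000`), `Far₂(y)` the sites that are not near₂; the stub (FAR₂) reads
`∃ κ > 0, ∀ N (y : Fin N → ℝ³) injective, N · e_χ* + κ · #Far₂(y) ≤ E_χ(y)`.

**Theorem (`defectFarSiteGap_iff_periodicDefectFarPricing`).**  (FAR₂) is EQUIVALENT to the
PERIODIC DEFECT-FAR-SITE PRICING

  `∃ κ > 0, ∀ Q : PeriodicConfiguration 3, κ · #{motif sites of Q that are defect-far in Q.points}`
  `   ≤ #F · (e_χ(Q) − e_χ*)`.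

So finite clusters, free surfaces and `N` play no role in (FAR₂): it is the statement "in
Blanc–Lewin's periodic universe, the excess `V_χ`-energy density of a periodic configuration
over the periodic infimum controls, linearly and uniformly, its density of sites whose
`a₀/2`-separated closed `3a₀`-patch is NOT in the elastic basin (two-way `a₀/8`-close to a
rigidly moved, `10 %`-strained ideal Barlow stacking)" — finite-range periodic crystallization
for `V_χ` with linear pricing of gross defects, the open core isolated by the line.

* `⇒` is part 2 (`periodicDefectFarPricing_of_defectFarSiteGap`, blocks);
* `⇐` (`defectFarSiteGap_of_periodicDefectFarPricing`): far periodisation `y + (8D+8)ℤ³`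
  (`ChargedEnergyGapNegative.periodiseFar`); by FAR₂-LOCALITY (radius `357/100 < 6D + 8`,
  the template's `mem_range_toPoint_of_dist_le`, reused — whence the import of
  `…FarPeriodicForm.lean`) its defect-far motif sites are exactly the defect-far sites of `y`
  (`dfar_motif_periodiseFar`, valid for every `N ≥ 1`), and its energy per particle is EXACTLY
  `E_χ(y)/N` (`energyPerParticle_periodiseFar_eq_div`, range `2 ≤ 8`); `N = 0` is trivial;
* consequences: the KILL CRITERION `lt_energyPerParticle_of_motifDefectFar` (under (FAR₂), a
  periodic configuration with one defect-far motif site is not a periodic `V_χ`-minimiser) and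
  the uniform gap `le_energyPerParticle_of_forall_motifDefectFar` (under (FAR₂), a periodic
  configuration ALL of whose motif sites are defect-far lies at least `κ` above `e_χ*` per
  particle).

Margin ledger: locality radius `357/100 < 8 ≤ 6D + 8` (unchanged from the template).
All `[folklore]` bookkeeping; the content of (FAR₂) is untouched.
-/

noncomputable section

namespace Summit.AtomisticToContinuum.Crystallization.Theorems.PricedLinkCensusTruncatedCensusGap

open Literature.MathematicalPhysics.StatisticalMechanics Literature.Geometry.DiscreteGeometry
open Summit.AtomisticToContinuum.Crystallization.Theorems.ChargedEnergyGapNegative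
open Summit.AtomisticToContinuum.Crystallization.Theorems.ChargedEnergyGapNegative.Blocks

/-! ## The far periodisation: defect-far motif sites are those of `y` -/

section FarPeriodisation

variable {N : ℕ}

/-- **The near₂ predicate of a motif point, read in the far periodisation, is that of `y`**
(`y` injective, any `N ≥ 1`; defect-far-site locality at radius `357/100 < 6D + 8`,
`mem_range_toPoint_of_dist_le`). [folklore] -/
theorem nearBasin_toPoint_iff {y : Fin N → E3} (hy : Function.Injective y) (hN : 0 < N)
    (i : Fin N) :
    (∃ (s : ℤ → ℤ) (F : EuclideanSpace ℝ (Fin 3) →L[ℝ] EuclideanSpace ℝ (Fin 3)) (g : EuclideanSpace ℝ (Fin 3) ≃ᵃⁱ[ℝ] EuclideanSpace ℝ (Fin 3)), Literature.MathematicalPhysics.StatisticalMechanics.IsHaggSeq s ∧ (∀ v : EuclideanSpace ℝ (Fin 3), ‖F v - (977 / 1000 : ℝ) • v‖ ≤ 977 / 10000 * ‖v‖) ∧ (∀ j k : (periodiseFar y hN).points, j ≠ k → dist ((Subtype.val : (periodiseFar y hN).points → EuclideanSpace ℝ (Fin 3)) j) ((Subtype.val : (periodiseFar y hN).points → EuclideanSpace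 ℝ (Fin 3)) (toPoint y hN i)) ≤ 2931 / 1000 → 977 / 2000 ≤ dist ((Subtype.val : (periodiseFar y hN).points → EuclideanSpace ℝ (Fin 3)) j) ((Subtype.val : (periodiseFar y hN).points → EuclideanSpace ℝ (Fin 3)) k)) ∧ (∀ j : (periodiseFar y hN).points, dist ((Subtype.val : (periodiseFar y hN).points → EuclideanSpace ℝ (Fin 3)) j) ((Subtype.val : (periodiseFar y hN).points → EuclideanSpace ℝ (Fin 3)) (toPoint y hN i)) ≤ 2931 / 1000 → ∃ z ∈ Literature.MathematicalPhysics.StatisticalMechanics.barlowStacking 1 (Real.sqrt (2 / 3)) s, dist ((Subtype.val : (periodiseFar y hN).points → EuclideanSpace ℝ (Fin 3)) j) (g (F z)) ≤ 977 / 8000) ∧ (∀ z ∈ Literature.MathematicalPhysics.StatisticalMechanics.barlowStacking 1 (Real.sqrt (2 / 3)) s, dist (g (F z)) ((Subtype.val : (periodiseFar y hN).points → EuclideanSpace ℝ (Fin 3)) (toPoint y hN i)) ≤ 2931 / 1000 → ∃ j : (periodiseFar y hN).points, dist ((Subtype.val : (periodiseFar y hN).points → EuclideanSpace ℝ (Fin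 3)) j) (g (F z)) ≤ 977 / 8000)) ↔
      (∃ (s : ℤ → ℤ) (F : EuclideanSpace ℝ (Fin 3) →L[ℝ] EuclideanSpace ℝ (Fin 3)) (g : EuclideanSpace ℝ (Fin 3) ≃ᵃⁱ[ℝ] EuclideanSpace ℝ (Fin 3)), Literature.MathematicalPhysics.StatisticalMechanics.IsHaggSeq s ∧ (∀ v : EuclideanSpace ℝ (Fin 3), ‖F v - (977 / 1000 : ℝ) • v‖ ≤ 977 / 10000 * ‖v‖) ∧ (∀ j k, j ≠ k → dist (y j) (y i) ≤ 2931 / 1000 → 977 / 2000 ≤ dist (y j) (y k)) ∧ (∀ j, dist (y j) (y i) ≤ 2931 / 1000 → ∃ z ∈ Literature.MathematicalPhysics.StatisticalMechanics.barlowStacking 1 (Real.sqrt (2 / 3)) s, dist (y j) (g (F z)) ≤ 977 / 8000) ∧ (∀ z ∈ Literature.MathematicalPhysics.StatisticalMechanics.barlowStacking 1 (Real.sqrt (2 / 3)) s, dist (g (F z)) (y i) ≤ 2931 / 1000 → ∃ j, dist (y j) (g (F z)) ≤ 977 / 8000)) := by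
  have hcomp : (Subtype.val : (periodiseFar y hN).points → EuclideanSpace ℝ (Fin 3)) ∘ toPoint y hN = y := funext fun _ => rfl
  have key := nearBasin_apply_iff_comp (Subtype.val : (periodiseFar y hN).points → EuclideanSpace ℝ (Fin 3)) (toPoint_injective hy hN) i
    (fun q hq => mem_range_toPoint_of_dist_le hN i q hq)
  rw [hcomp] at key
  exact key

/-- Hence the far periodisation has exactly `#Far₂(y)` defect-far motif sites. [folklore] -/
theorem dfar_motif_periodiseFar {y : Fin N → E3} (hy : Function.Injective y) (hN : 0 < N) :
    Nat.card {x : (periodiseFar y hN).motif // ¬ ∃ (s : ℤ → ℤ) (F : EuclideanSpace ℝ (Fin 3) →L[ℝ] EuclideanSpace ℝ (Fin 3)) (g : EuclideanSpace ℝ (Fin 3) ≃ᵃⁱ[ℝ] EuclideanSpace ℝ (Fin 3)), Literature.MathematicalPhysics.StatisticalMechanics.IsHaggSeq s ∧ (∀ v : EuclideanSpace ℝ (Fin 3), ‖F v - (977 / 1000 : ℝ) • v‖ ≤ 977 / 10000 * ‖v‖) ∧ (∀ j k : (periodiseFar y hN).points, j ≠ k → dist ((Subtype.val : (periodiseFar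 y hN).points → EuclideanSpace ℝ (Fin 3)) j) ((Subtype.val : (periodiseFar y hN).points → EuclideanSpace ℝ (Fin 3)) ⟨x.1, (periodiseFar y hN).mem_points_of_mem_motif x.2⟩) ≤ 2931 / 1000 → 977 / 2000 ≤ dist ((Subtype.val : (periodiseFar y hN).points → EuclideanSpace ℝ (Fin 3)) j) ((Subtype.val : (periodiseFar y hN).points → EuclideanSpace ℝ (Fin 3)) k)) ∧ (∀ j : (periodiseFar y hN).points, dist ((Subtype.val : (periodiseFar y hN).points → EuclideanSpace ℝ (Fin 3)) j) ((Subtype.val : (periodiseFar y hN).points → EuclideanSpace ℝ (Fin 3)) ⟨x.1, (periodiseFar y hN).mem_points_of_mem_motif x.2⟩) ≤ 2931 / 1000 → ∃ z ∈ Literature.MathematicalPhysics.StatisticalMechanics.barlowStacking 1 (Real.sqrt (2 / 3)) s, dist ((Subtype.val : (periodiseFar y hN).points → EuclideanSpace ℝ (Fin 3)) j) (g (F z)) ≤ 977 / 8000) ∧ (∀ z ∈ Literature.MathematicalPhysics.StatisticalMechanics.barlowStacking 1 (Real.sqrt (2 / 3)) s, dist (g (F z)) ((Subtype.val : (periodiseFar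 y hN).points → EuclideanSpace ℝ (Fin 3)) ⟨x.1, (periodiseFar y hN).mem_points_of_mem_motif x.2⟩) ≤ 2931 / 1000 → ∃ j : (periodiseFar y hN).points, dist ((Subtype.val : (periodiseFar y hN).points → EuclideanSpace ℝ (Fin 3)) j) (g (F z)) ≤ 977 / 8000)} =
      Nat.card {i : Fin N // ¬ ∃ (s : ℤ → ℤ) (F : EuclideanSpace ℝ (Fin 3) →L[ℝ] EuclideanSpace ℝ (Fin 3)) (g : EuclideanSpace ℝ (Fin 3) ≃ᵃⁱ[ℝ] EuclideanSpace ℝ (Fin 3)), Literature.MathematicalPhysics.StatisticalMechanics.IsHaggSeq s ∧ (∀ v : EuclideanSpace ℝ (Fin 3), ‖F v - (977 / 1000 : ℝ) • v‖ ≤ 977 / 10000 * ‖v‖) ∧ (∀ j k, j ≠ k → dist (y j) (y i) ≤ 2931 / 1000 → 977 / 2000 ≤ dist (y j) (y k)) ∧ (∀ j, dist (y j) (y i) ≤ 2931 / 1000 → ∃ z ∈ Literature.MathematicalPhysics.StatisticalMechanics.barlowStacking 1 (Real.sqrt (2 / 3)) s, dist (y j) (g (F z)) ≤ 977 / 8000)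 ∧ (∀ z ∈ Literature.MathematicalPhysics.StatisticalMechanics.barlowStacking 1 (Real.sqrt (2 / 3)) s, dist (g (F z)) (y i) ≤ 2931 / 1000 → ∃ j, dist (y j) (g (F z)) ≤ 977 / 8000)} := by
  let f : {i : Fin N // ¬ ∃ (s : ℤ → ℤ) (F : EuclideanSpace ℝ (Fin 3) →L[ℝ] EuclideanSpace ℝ (Fin 3)) (g : EuclideanSpace ℝ (Fin 3) ≃ᵃⁱ[ℝ] EuclideanSpace ℝ (Fin 3)), Literature.MathematicalPhysics.StatisticalMechanics.IsHaggSeq s ∧ (∀ v : EuclideanSpace ℝ (Fin 3), ‖F v - (977 / 1000 : ℝ) • v‖ ≤ 977 / 10000 * ‖v‖) ∧ (∀ j k, j ≠ k → dist (y j) (y i) ≤ 2931 / 1000 → 977 / 2000 ≤ dist (y j) (y k)) ∧ (∀ j, dist (y j) (y i) ≤ 2931 / 1000 → ∃ z ∈ Literature.MathematicalPhysics.StatisticalMechanics.barlowStacking 1 (Real.sqrt (2 / 3)) s, dist (y j) (g (F z)) ≤ 977 / 8000) ∧ (∀ z ∈ Literature.MathematicalPhysics.StatisticalMechanics.barlowStacking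 1 (Real.sqrt (2 / 3)) s, dist (g (F z)) (y i) ≤ 2931 / 1000 → ∃ j, dist (y j) (g (F z)) ≤ 977 / 8000)} →
      {x : (periodiseFar y hN).motif // ¬ ∃ (s : ℤ → ℤ) (F : EuclideanSpace ℝ (Fin 3) →L[ℝ] EuclideanSpace ℝ (Fin 3)) (g : EuclideanSpace ℝ (Fin 3) ≃ᵃⁱ[ℝ] EuclideanSpace ℝ (Fin 3)), Literature.MathematicalPhysics.StatisticalMechanics.IsHaggSeq s ∧ (∀ v : EuclideanSpace ℝ (Fin 3), ‖F v - (977 / 1000 : ℝ) • v‖ ≤ 977 / 10000 * ‖v‖) ∧ (∀ j k : (periodiseFar y hN).points, j ≠ k → dist ((Subtype.val : (periodiseFar y hN).points → EuclideanSpace ℝ (Fin 3)) j) ((Subtype.val : (periodiseFar y hN).points → EuclideanSpace ℝ (Fin 3)) ⟨x.1, (periodiseFar y hN).mem_points_of_mem_motif x.2⟩) ≤ 2931 / 1000 → 977 / 2000 ≤ dist ((Subtype.val : (periodiseFar y hN).points → EuclideanSpace ℝ (Fin 3)) j) ((Subtype.val : (periodiseFar y hN).points → EuclideanSpace ℝ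 (Fin 3)) k)) ∧ (∀ j : (periodiseFar y hN).points, dist ((Subtype.val : (periodiseFar y hN).points → EuclideanSpace ℝ (Fin 3)) j) ((Subtype.val : (periodiseFar y hN).points → EuclideanSpace ℝ (Fin 3)) ⟨x.1, (periodiseFar y hN).mem_points_of_mem_motif x.2⟩) ≤ 2931 / 1000 → ∃ z ∈ Literature.MathematicalPhysics.StatisticalMechanics.barlowStacking 1 (Real.sqrt (2 / 3)) s, dist ((Subtype.val : (periodiseFar y hN).points → EuclideanSpace ℝ (Fin 3)) j) (g (F z)) ≤ 977 / 8000) ∧ (∀ z ∈ Literature.MathematicalPhysics.StatisticalMechanics.barlowStacking 1 (Real.sqrt (2 / 3)) s, dist (g (F z)) ((Subtype.val : (periodiseFar y hN).points → EuclideanSpace ℝ (Fin 3)) ⟨x.1, (periodiseFar y hN).mem_points_of_mem_motif x.2⟩) ≤ 2931 / 1000 → ∃ j : (periodiseFar y hN).points, dist ((Subtype.val : (periodiseFar y hN).points → EuclideanSpace ℝ (Fin 3)) j) (g (F z)) ≤ 977 / 8000)} :=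
    fun i => ⟨⟨y i.1, mem_motif_periodiseFar y hN i.1⟩, by
      have h := i.2
      rw [← nearBasin_toPoint_iff hy hN i.1] at h
      exact h⟩
  have hf : Function.Bijective f := by
    constructor
    · intro a b hab
      have : y a.1 = y b.1 := congrArg (fun z => ((z.1 : (periodiseFar y hN).motif) : E3)) hab
      exact Subtype.ext (hy this)
    · rintro ⟨⟨v, hv⟩, hc⟩
      have hv' := hv
      rw [motif_periodiseFar] at hv'
      obtain ⟨i, -, rfl⟩ := Finset.mem_image.1 hv'
      refine ⟨⟨i, ?_⟩, rfl⟩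
      rw [← nearBasin_toPoint_iff hy hN i]
      exact hc
  exact (Nat.card_congr (Equiv.ofBijective f hf)).symm

end FarPeriodisation

/-! ## The periodic defect-far-site pricing ⇒ (FAR₂) (far periodisation) -/

/-- **The periodic defect-far-site pricing implies the defect far-site gap** (same `κ`): far
periodisation for `N ≥ 1` (its defect-far motif sites are those of `y`, its energy per
particle is exactly `E_χ(y)/N`); `N = 0` is trivial. [folklore] -/
theorem defectFarSiteGap_of_periodicDefectFarPricing : (∃ κ : ℝ, 0 < κ ∧ ∀ Q : Literature.MathematicalPhysics.StatisticalMechanics.PeriodicConfiguration 3, κ * (Nat.card {x : Q.motif // ¬ ∃ (s : ℤ → ℤ) (F : EuclideanSpace ℝ (Fin 3) →L[ℝ] EuclideanSpace ℝ (Fin 3)) (g : EuclideanSpace ℝ (Fin 3) ≃ᵃⁱ[ℝ] EuclideanSpace ℝ (Fin 3)), Literature.MathematicalPhysics.StatisticalMechanics.IsHaggSeq s ∧ (∀ v : EuclideanSpace ℝ (Fin 3), ‖F v - (977 / 1000 : ℝ) • v‖ ≤ 977 / 10000 * ‖v‖) ∧ (∀ j k : Q.points, j ≠ k → dist ((Subtype.val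 : Q.points → EuclideanSpace ℝ (Fin 3)) j) ((Subtype.val : Q.points → EuclideanSpace ℝ (Fin 3)) ⟨x.1, Q.mem_points_of_mem_motif x.2⟩) ≤ 2931 / 1000 → 977 / 2000 ≤ dist ((Subtype.val : Q.points → EuclideanSpace ℝ (Fin 3)) j) ((Subtype.val : Q.points → EuclideanSpace ℝ (Fin 3)) k)) ∧ (∀ j : Q.points, dist ((Subtype.val : Q.points → EuclideanSpace ℝ (Fin 3)) j) ((Subtype.val : Q.points → EuclideanSpace ℝ (Fin 3)) ⟨x.1, Q.mem_points_of_mem_motif x.2⟩) ≤ 2931 / 1000 → ∃ z ∈ Literature.MathematicalPhysics.StatisticalMechanics.barlowStacking 1 (Real.sqrt (2 / 3)) s, dist ((Subtype.val : Q.points → EuclideanSpace ℝ (Fin 3)) j) (g (F z)) ≤ 977 / 8000) ∧ (∀ z ∈ Literature.MathematicalPhysics.StatisticalMechanics.barlowStacking 1 (Real.sqrt (2 / 3)) s, dist (g (F z)) ((Subtype.val : Q.points → EuclideanSpace ℝ (Fin 3)) ⟨x.1, Q.mem_points_of_mem_motif x.2⟩) ≤ 2931 / 1000 → ∃ j : Q.points,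 dist ((Subtype.val : Q.points → EuclideanSpace ℝ (Fin 3)) j) (g (F z)) ≤ 977 / 8000)} : ℝ) ≤ (Q.motif.card : ℝ) * (Q.energyPerParticle (fun r => min 1 (max 0 (4 - 2 * r)) * Literature.MathematicalPhysics.StatisticalMechanics.lennardJones r) - ⨅ Q' : Literature.MathematicalPhysics.StatisticalMechanics.PeriodicConfiguration 3, Q'.energyPerParticle (fun r => min 1 (max 0 (4 - 2 * r)) * Literature.MathematicalPhysics.StatisticalMechanics.lennardJones r))) → (∃ κ : ℝ, 0 < κ ∧ ∀ (N : ℕ) (y : Fin N → EuclideanSpace ℝ (Fin 3)), Function.Injective y → (N : ℝ) * (⨅ Q : Literature.MathematicalPhysics.StatisticalMechanics.PeriodicConfiguration 3, Q.energyPerParticle (fun r => min 1 (max 0 (4 - 2 * r)) * Literature.MathematicalPhysics.StatisticalMechanics.lennardJones r)) + κ * (Nat.card {i : Fin N // ¬ ∃ (s : ℤ → ℤ) (F : EuclideanSpace ℝ (Fin 3) →L[ℝ] EuclideanSpace ℝ (Fin 3)) (g : EuclideanSpace ℝ (Fin 3) ≃ᵃⁱ[ℝ] EuclideanSpace ℝ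 (Fin 3)), Literature.MathematicalPhysics.StatisticalMechanics.IsHaggSeq s ∧ (∀ v : EuclideanSpace ℝ (Fin 3), ‖F v - (977 / 1000 : ℝ) • v‖ ≤ 977 / 10000 * ‖v‖) ∧ (∀ j k : Fin N, j ≠ k → dist (y j) (y i) ≤ 2931 / 1000 → 977 / 2000 ≤ dist (y j) (y k)) ∧ (∀ j : Fin N, dist (y j) (y i) ≤ 2931 / 1000 → ∃ z ∈ Literature.MathematicalPhysics.StatisticalMechanics.barlowStacking 1 (Real.sqrt (2 / 3)) s, dist (y j) (g (F z)) ≤ 977 / 8000) ∧ (∀ z ∈ Literature.MathematicalPhysics.StatisticalMechanics.barlowStacking 1 (Real.sqrt (2 / 3)) s, dist (g (F z)) (y i) ≤ 2931 / 1000 → ∃ j : Fin N, dist (y j) (g (F z)) ≤ 977 / 8000)} : ℝ) ≤ Literature.MathematicalPhysics.StatisticalMechanics.interactionEnergy (fun r => min 1 (max 0 (4 - 2 * r)) * Literature.MathematicalPhysics.StatisticalMechanics.lennardJones r) y) := by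
  rintro ⟨κ, hκ, h⟩
  refine ⟨κ, hκ, fun N y hy => ?_⟩
  rcases Nat.eq_zero_or_pos N with rfl | hN0
  · rw [Nat.card_of_isEmpty, interactionEnergy_of_subsingleton]
    simp
  · have hp := h (periodiseFar y hN0)
    rw [dfar_motif_periodiseFar hy hN0] at hp
    have hcard : (((periodiseFar y hN0).motif.card : ℕ) : ℝ) = N := by
      rw [motif_periodiseFar, Finset.card_image_of_injective _ hy, Finset.card_univ,
        Fintype.card_fin]
    have he : (periodiseFar y hN0).energyPerParticle
        (fun r => min 1 (max 0 (4 - 2 * r)) * lennardJones r) =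
        interactionEnergy (fun r => min 1 (max 0 (4 - 2 * r)) * lennardJones r) y / N :=
      energyPerParticle_periodiseFar_eq_div truncLJ_eq_zero_of_two_le (by norm_num) hy hN0
    rw [hcard, he] at hp
    -- hide the far count and the energy behind opaque names before the arithmetic
    generalize (Nat.card {i : Fin N // ¬ ∃ (s : ℤ → ℤ) (F : EuclideanSpace ℝ (Fin 3) →L[ℝ] EuclideanSpace ℝ (Fin 3)) (g : EuclideanSpace ℝ (Fin 3) ≃ᵃⁱ[ℝ] EuclideanSpace ℝ (Fin 3)), Literature.MathematicalPhysics.StatisticalMechanics.IsHaggSeq s ∧ (∀ v : EuclideanSpace ℝ (Fin 3), ‖F v - (977 / 1000 : ℝ) • v‖ ≤ 977 / 10000 * ‖v‖) ∧ (∀ j k : Fin N, j ≠ k → dist (y j) (y i) ≤ 2931 / 1000 → 977 / 2000 ≤ dist (y j) (y k)) ∧ (∀ j : Fin N, dist (y j) (y i) ≤ 2931 / 1000 → ∃ z ∈ Literature.MathematicalPhysics.StatisticalMechanics.barlowStacking 1 (Real.sqrt (2 / 3)) s, dist (y j) (g (F z)) ≤ 977 / 8000) ∧ (∀ z ∈ Literature.MathematicalPhysics.StatisticalMechanics.barlowStacking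 1 (Real.sqrt (2 / 3)) s, dist (g (F z)) (y i) ≤ 2931 / 1000 → ∃ j : Fin N, dist (y j) (g (F z)) ≤ 977 / 8000)} : ℝ) = m at hp ⊢
    generalize interactionEnergy (fun r => min 1 (max 0 (4 - 2 * r)) * lennardJones r) y = E
      at hp ⊢
    have hNr : (0 : ℝ) < N := by exact_mod_cast hN0
    have hmul : (N : ℝ) * (E / N) = E := by field_simp
    rw [mul_sub, hmul] at hp
    linarith

/-! ## The equivalence, and two consequences -/

/-- **The defect far-site gap (FAR₂) is EQUIVALENT to the periodic defect-far-site pricing for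
`V_χ`** (registered sub-goal; the FAR₂-twin of `farSiteGap_iff_periodicFarPricing`,
`truncatedCensusGap_iff_periodicPricing` and `underCoordinationGap_iff_periodicUnderPricing`):
the precise open content of the stub `stub_defectFarSiteGap` — finite-range periodic
crystallization for `V_χ` with linear pricing of the sites outside the elastic basin.
[folklore] -/
theorem defectFarSiteGap_iff_periodicDefectFarPricing : (∃ κ : ℝ, 0 < κ ∧ ∀ (N : ℕ) (y : Fin N → EuclideanSpace ℝ (Fin 3)), Function.Injective y → (N : ℝ) * (⨅ Q : Literature.MathematicalPhysics.StatisticalMechanics.PeriodicConfiguration 3, Q.energyPerParticle (fun r => min 1 (max 0 (4 - 2 * r)) * Literature.MathematicalPhysics.StatisticalMechanics.lennardJones r)) + κ * (Nat.card {i : Fin N // ¬ ∃ (s : ℤ → ℤ) (F : EuclideanSpace ℝ (Fin 3) →L[ℝ] EuclideanSpace ℝ (Fin 3)) (g : EuclideanSpace ℝ (Fin 3) ≃ᵃⁱ[ℝ] EuclideanSpace ℝ (Fin 3)), Literature.MathematicalPhysics.StatisticalMechanics.IsHaggSeq s ∧ (∀ v : EuclideanSpace ℝ (Fin 3), ‖F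 v - (977 / 1000 : ℝ) • v‖ ≤ 977 / 10000 * ‖v‖) ∧ (∀ j k : Fin N, j ≠ k → dist (y j) (y i) ≤ 2931 / 1000 → 977 / 2000 ≤ dist (y j) (y k)) ∧ (∀ j : Fin N, dist (y j) (y i) ≤ 2931 / 1000 → ∃ z ∈ Literature.MathematicalPhysics.StatisticalMechanics.barlowStacking 1 (Real.sqrt (2 / 3)) s, dist (y j) (g (F z)) ≤ 977 / 8000) ∧ (∀ z ∈ Literature.MathematicalPhysics.StatisticalMechanics.barlowStacking 1 (Real.sqrt (2 / 3)) s, dist (g (F z)) (y i) ≤ 2931 / 1000 → ∃ j : Fin N, dist (y j) (g (F z)) ≤ 977 / 8000)} : ℝ) ≤ Literature.MathematicalPhysics.StatisticalMechanics.interactionEnergy (fun r => min 1 (max 0 (4 - 2 * r)) * Literature.MathematicalPhysics.StatisticalMechanics.lennardJones r) y) ↔ (∃ κ : ℝ, 0 < κ ∧ ∀ Q : Literature.MathematicalPhysics.StatisticalMechanics.PeriodicConfiguration 3, κ * (Nat.card {x : Q.motif // ¬ ∃ (s : ℤ → ℤ) (F : EuclideanSpace ℝ (Fin 3) →L[ℝ]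 EuclideanSpace ℝ (Fin 3)) (g : EuclideanSpace ℝ (Fin 3) ≃ᵃⁱ[ℝ] EuclideanSpace ℝ (Fin 3)), Literature.MathematicalPhysics.StatisticalMechanics.IsHaggSeq s ∧ (∀ v : EuclideanSpace ℝ (Fin 3), ‖F v - (977 / 1000 : ℝ) • v‖ ≤ 977 / 10000 * ‖v‖) ∧ (∀ j k : Q.points, j ≠ k → dist ((Subtype.val : Q.points → EuclideanSpace ℝ (Fin 3)) j) ((Subtype.val : Q.points → EuclideanSpace ℝ (Fin 3)) ⟨x.1, Q.mem_points_of_mem_motif x.2⟩) ≤ 2931 / 1000 → 977 / 2000 ≤ dist ((Subtype.val : Q.points → EuclideanSpace ℝ (Fin 3)) j) ((Subtype.val : Q.points → EuclideanSpace ℝ (Fin 3)) k)) ∧ (∀ j : Q.points, dist ((Subtype.val : Q.points → EuclideanSpace ℝ (Fin 3)) j) ((Subtype.val : Q.points → EuclideanSpace ℝ (Fin 3)) ⟨x.1, Q.mem_points_of_mem_motif x.2⟩) ≤ 2931 / 1000 → ∃ z ∈ Literature.MathematicalPhysics.StatisticalMechanics.barlowStacking 1 (Real.sqrt (2 / 3))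 s, dist ((Subtype.val : Q.points → EuclideanSpace ℝ (Fin 3)) j) (g (F z)) ≤ 977 / 8000) ∧ (∀ z ∈ Literature.MathematicalPhysics.StatisticalMechanics.barlowStacking 1 (Real.sqrt (2 / 3)) s, dist (g (F z)) ((Subtype.val : Q.points → EuclideanSpace ℝ (Fin 3)) ⟨x.1, Q.mem_points_of_mem_motif x.2⟩) ≤ 2931 / 1000 → ∃ j : Q.points, dist ((Subtype.val : Q.points → EuclideanSpace ℝ (Fin 3)) j) (g (F z)) ≤ 977 / 8000)} : ℝ) ≤ (Q.motif.card : ℝ) * (Q.energyPerParticle (fun r => min 1 (max 0 (4 - 2 * r)) * Literature.MathematicalPhysics.StatisticalMechanics.lennardJones r) - ⨅ Q' : Literature.MathematicalPhysics.StatisticalMechanics.PeriodicConfiguration 3, Q'.energyPerParticle (fun r => min 1 (max 0 (4 - 2 * r)) * Literature.MathematicalPhysics.StatisticalMechanics.lennardJones r))) :=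
  ⟨periodicDefectFarPricing_of_defectFarSiteGap, defectFarSiteGap_of_periodicDefectFarPricing⟩

/-- **Kill criterion for (FAR₂).**  Under the defect far-site gap, a periodic configuration
with at least one DEFECT-FAR motif site (read in the infinite point set `Q.points`) lies
STRICTLY above the periodic infimum: `e_χ* < e_χ(Q)`.  Contrapositive: a periodic
`V_χ`-minimiser with a defect-far site (a site whose `3a₀`-patch is not in the elastic basin)
refutes (FAR₂), hence the line. [folklore] -/
theorem lt_energyPerParticle_of_motifDefectFar
    (hFar : ∃ κ : ℝ, 0 < κ ∧ ∀ (N : ℕ) (y : Fin N → EuclideanSpace ℝ (Fin 3)), Function.Injective y → (N : ℝ) * (⨅ Q : Literature.MathematicalPhysics.StatisticalMechanics.PeriodicConfiguration 3, Q.energyPerParticle (fun r => min 1 (max 0 (4 - 2 * r)) * Literature.MathematicalPhysics.StatisticalMechanics.lennardJones r)) + κ * (Nat.card {i : Fin N // ¬ ∃ (s : ℤ → ℤ) (F : EuclideanSpace ℝ (Fin 3) →L[ℝ] EuclideanSpace ℝ (Fin 3)) (g : EuclideanSpace ℝ (Fin 3) ≃ᵃⁱ[ℝ] EuclideanSpace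 ℝ (Fin 3)), Literature.MathematicalPhysics.StatisticalMechanics.IsHaggSeq s ∧ (∀ v : EuclideanSpace ℝ (Fin 3), ‖F v - (977 / 1000 : ℝ) • v‖ ≤ 977 / 10000 * ‖v‖) ∧ (∀ j k : Fin N, j ≠ k → dist (y j) (y i) ≤ 2931 / 1000 → 977 / 2000 ≤ dist (y j) (y k)) ∧ (∀ j : Fin N, dist (y j) (y i) ≤ 2931 / 1000 → ∃ z ∈ Literature.MathematicalPhysics.StatisticalMechanics.barlowStacking 1 (Real.sqrt (2 / 3)) s, dist (y j) (g (F z)) ≤ 977 / 8000) ∧ (∀ z ∈ Literature.MathematicalPhysics.StatisticalMechanics.barlowStacking 1 (Real.sqrt (2 / 3)) s, dist (g (F z)) (y i) ≤ 2931 / 1000 → ∃ j : Fin N, dist (y j) (g (F z)) ≤ 977 / 8000)} : ℝ) ≤ Literature.MathematicalPhysics.StatisticalMechanics.interactionEnergy (fun r => min 1 (max 0 (4 - 2 * r)) * Literature.MathematicalPhysics.StatisticalMechanics.lennardJones r) y)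
    (Q : PeriodicConfiguration 3)
    (hQ : 0 < Nat.card {x : Q.motif // ¬ ∃ (s : ℤ → ℤ) (F : EuclideanSpace ℝ (Fin 3) →L[ℝ] EuclideanSpace ℝ (Fin 3)) (g : EuclideanSpace ℝ (Fin 3) ≃ᵃⁱ[ℝ] EuclideanSpace ℝ (Fin 3)), Literature.MathematicalPhysics.StatisticalMechanics.IsHaggSeq s ∧ (∀ v : EuclideanSpace ℝ (Fin 3), ‖F v - (977 / 1000 : ℝ) • v‖ ≤ 977 / 10000 * ‖v‖) ∧ (∀ j k : Q.points, j ≠ k → dist ((Subtype.val : Q.points → EuclideanSpace ℝ (Fin 3)) j) ((Subtype.val : Q.points → EuclideanSpace ℝ (Fin 3)) ⟨x.1, Q.mem_points_of_mem_motif x.2⟩) ≤ 2931 / 1000 → 977 / 2000 ≤ dist ((Subtype.val : Q.points → EuclideanSpace ℝ (Fin 3)) j) ((Subtype.val : Q.points → EuclideanSpace ℝ (Fin 3)) k)) ∧ (∀ j : Q.points, dist ((Subtype.val : Q.points → EuclideanSpace ℝ (Fin 3)) j) ((Subtype.val : Q.points → EuclideanSpace ℝ (Fin 3)) ⟨x.1,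 Q.mem_points_of_mem_motif x.2⟩) ≤ 2931 / 1000 → ∃ z ∈ Literature.MathematicalPhysics.StatisticalMechanics.barlowStacking 1 (Real.sqrt (2 / 3)) s, dist ((Subtype.val : Q.points → EuclideanSpace ℝ (Fin 3)) j) (g (F z)) ≤ 977 / 8000) ∧ (∀ z ∈ Literature.MathematicalPhysics.StatisticalMechanics.barlowStacking 1 (Real.sqrt (2 / 3)) s, dist (g (F z)) ((Subtype.val : Q.points → EuclideanSpace ℝ (Fin 3)) ⟨x.1, Q.mem_points_of_mem_motif x.2⟩) ≤ 2931 / 1000 → ∃ j : Q.points, dist ((Subtype.val : Q.points → EuclideanSpace ℝ (Fin 3)) j) (g (F z)) ≤ 977 / 8000)}) :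
    (⨅ Q' : PeriodicConfiguration 3,
        Q'.energyPerParticle (fun r => min 1 (max 0 (4 - 2 * r)) * lennardJones r)) <
      Q.energyPerParticle (fun r => min 1 (max 0 (4 - 2 * r)) * lennardJones r) := by
  obtain ⟨κ, hκ, hp⟩ := periodicDefectFarPricing_of_defectFarSiteGap hFar
  have h1 := hp Q
  revert h1 hQ
  generalize Nat.card {x : Q.motif // ¬ ∃ (s : ℤ → ℤ) (F : EuclideanSpace ℝ (Fin 3) →L[ℝ] EuclideanSpace ℝ (Fin 3)) (g : EuclideanSpace ℝ (Fin 3) ≃ᵃⁱ[ℝ] EuclideanSpace ℝ (Fin 3)), Literature.MathematicalPhysics.StatisticalMechanics.IsHaggSeq s ∧ (∀ v : EuclideanSpace ℝ (Fin 3), ‖F v - (977 / 1000 : ℝ) • v‖ ≤ 977 / 10000 * ‖v‖) ∧ (∀ j k : Q.points, j ≠ k → dist ((Subtype.val : Q.points → EuclideanSpace ℝ (Fin 3)) j) ((Subtype.val : Q.points → EuclideanSpace ℝ (Fin 3)) ⟨x.1, Q.mem_points_of_mem_motif x.2⟩) ≤ 2931 / 1000 → 977 / 2000 ≤ dist ((Subtype.val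 : Q.points → EuclideanSpace ℝ (Fin 3)) j) ((Subtype.val : Q.points → EuclideanSpace ℝ (Fin 3)) k)) ∧ (∀ j : Q.points, dist ((Subtype.val : Q.points → EuclideanSpace ℝ (Fin 3)) j) ((Subtype.val : Q.points → EuclideanSpace ℝ (Fin 3)) ⟨x.1, Q.mem_points_of_mem_motif x.2⟩) ≤ 2931 / 1000 → ∃ z ∈ Literature.MathematicalPhysics.StatisticalMechanics.barlowStacking 1 (Real.sqrt (2 / 3)) s, dist ((Subtype.val : Q.points → EuclideanSpace ℝ (Fin 3)) j) (g (F z)) ≤ 977 / 8000) ∧ (∀ z ∈ Literature.MathematicalPhysics.StatisticalMechanics.barlowStacking 1 (Real.sqrt (2 / 3)) s, dist (g (F z)) ((Subtype.val : Q.points → EuclideanSpace ℝ (Fin 3)) ⟨x.1, Q.mem_points_of_mem_motif x.2⟩) ≤ 2931 / 1000 → ∃ j : Q.points, dist ((Subtype.val : Q.points → EuclideanSpace ℝ (Fin 3)) j) (g (F z)) ≤ 977 / 8000)} = m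
  intro hQ h1
  have hF : (0 : ℝ) < Q.motif.card := by exact_mod_cast Q.motif_nonempty.card_pos
  have hm : (1 : ℝ) ≤ m := by exact_mod_cast hQ
  have hpos : 0 < κ * (m : ℝ) := mul_pos hκ (by linarith)
  by_contra hle
  push Not at hle
  have : (Q.motif.card : ℝ) * (Q.energyPerParticle (fun r => min 1 (max 0 (4 - 2 * r)) * lennardJones r) -
      ⨅ Q' : PeriodicConfiguration 3,
        Q'.energyPerParticle (fun r => min 1 (max 0 (4 - 2 * r)) * lennardJones r)) ≤ 0 :=
    mul_nonpos_of_nonneg_of_nonpos hF.le (by linarith)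
  linarith

/-- **Uniform gap for everywhere-defect-far periodic configurations.**  (FAR₂) yields `κ > 0`
such that every periodic configuration ALL of whose motif sites are defect-far in `Q.points`
satisfies `e_χ* + κ ≤ e_χ(Q)`: periodic structures that are nowhere in the elastic basin (at
the tolerances of the line) are uniformly gapped above the periodic infimum. [folklore] -/
theorem le_energyPerParticle_of_forall_motifDefectFar
    (hFar : ∃ κ : ℝ, 0 < κ ∧ ∀ (N : ℕ) (y : Fin N → EuclideanSpace ℝ (Fin 3)), Function.Injective y → (N : ℝ) * (⨅ Q : Literature.MathematicalPhysics.StatisticalMechanics.PeriodicConfiguration 3, Q.energyPerParticle (fun r => min 1 (max 0 (4 - 2 * r)) * Literature.MathematicalPhysics.StatisticalMechanics.lennardJones r)) + κ * (Nat.card {i : Fin N // ¬ ∃ (s : ℤ → ℤ) (F : EuclideanSpace ℝ (Fin 3) →L[ℝ] EuclideanSpace ℝ (Fin 3)) (g : EuclideanSpace ℝ (Fin 3) ≃ᵃⁱ[ℝ] EuclideanSpace ℝ (Fin 3)), Literature.MathematicalPhysics.StatisticalMechanics.IsHaggSeq s ∧ (∀ v : EuclideanSpace ℝ (Fin 3),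 ‖F v - (977 / 1000 : ℝ) • v‖ ≤ 977 / 10000 * ‖v‖) ∧ (∀ j k : Fin N, j ≠ k → dist (y j) (y i) ≤ 2931 / 1000 → 977 / 2000 ≤ dist (y j) (y k)) ∧ (∀ j : Fin N, dist (y j) (y i) ≤ 2931 / 1000 → ∃ z ∈ Literature.MathematicalPhysics.StatisticalMechanics.barlowStacking 1 (Real.sqrt (2 / 3)) s, dist (y j) (g (F z)) ≤ 977 / 8000) ∧ (∀ z ∈ Literature.MathematicalPhysics.StatisticalMechanics.barlowStacking 1 (Real.sqrt (2 / 3)) s, dist (g (F z)) (y i) ≤ 2931 / 1000 → ∃ j : Fin N, dist (y j) (g (F z)) ≤ 977 / 8000)} : ℝ) ≤ Literature.MathematicalPhysics.StatisticalMechanics.interactionEnergy (fun r => min 1 (max 0 (4 - 2 * r)) * Literature.MathematicalPhysics.StatisticalMechanics.lennardJones r) y) :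
    ∃ κ : ℝ, 0 < κ ∧ ∀ Q : PeriodicConfiguration 3,
      (∀ x : Q.motif, ¬ ∃ (s : ℤ → ℤ) (F : EuclideanSpace ℝ (Fin 3) →L[ℝ] EuclideanSpace ℝ (Fin 3)) (g : EuclideanSpace ℝ (Fin 3) ≃ᵃⁱ[ℝ] EuclideanSpace ℝ (Fin 3)), Literature.MathematicalPhysics.StatisticalMechanics.IsHaggSeq s ∧ (∀ v : EuclideanSpace ℝ (Fin 3), ‖F v - (977 / 1000 : ℝ) • v‖ ≤ 977 / 10000 * ‖v‖) ∧ (∀ j k : Q.points, j ≠ k → dist ((Subtype.val : Q.points → EuclideanSpace ℝ (Fin 3)) j) ((Subtype.val : Q.points → EuclideanSpace ℝ (Fin 3)) ⟨x.1, Q.mem_points_of_mem_motif x.2⟩) ≤ 2931 / 1000 → 977 / 2000 ≤ dist ((Subtype.val : Q.points → EuclideanSpace ℝ (Fin 3)) j) ((Subtype.val : Q.points → EuclideanSpace ℝ (Fin 3)) k)) ∧ (∀ j : Q.points, dist ((Subtype.val : Q.points → EuclideanSpace ℝ (Fin 3)) j) ((Subtype.val : Q.points → EuclideanSpace ℝ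 (Fin 3)) ⟨x.1, Q.mem_points_of_mem_motif x.2⟩) ≤ 2931 / 1000 → ∃ z ∈ Literature.MathematicalPhysics.StatisticalMechanics.barlowStacking 1 (Real.sqrt (2 / 3)) s, dist ((Subtype.val : Q.points → EuclideanSpace ℝ (Fin 3)) j) (g (F z)) ≤ 977 / 8000) ∧ (∀ z ∈ Literature.MathematicalPhysics.StatisticalMechanics.barlowStacking 1 (Real.sqrt (2 / 3)) s, dist (g (F z)) ((Subtype.val : Q.points → EuclideanSpace ℝ (Fin 3)) ⟨x.1, Q.mem_points_of_mem_motif x.2⟩) ≤ 2931 / 1000 → ∃ j : Q.points, dist ((Subtype.val : Q.points → EuclideanSpace ℝ (Fin 3)) j) (g (F z)) ≤ 977 / 8000)) →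
      (⨅ Q' : PeriodicConfiguration 3,
          Q'.energyPerParticle (fun r => min 1 (max 0 (4 - 2 * r)) * lennardJones r)) + κ ≤
        Q.energyPerParticle (fun r => min 1 (max 0 (4 - 2 * r)) * lennardJones r) := by
  obtain ⟨κ, hκ, hp⟩ := periodicDefectFarPricing_of_defectFarSiteGap hFar
  refine ⟨κ, hκ, fun Q hall => ?_⟩
  have h1 := hp Q
  have hcard : Nat.card {x : Q.motif // ¬ ∃ (s : ℤ → ℤ) (F : EuclideanSpace ℝ (Fin 3) →L[ℝ] EuclideanSpace ℝ (Fin 3)) (g : EuclideanSpace ℝ (Fin 3) ≃ᵃⁱ[ℝ] EuclideanSpace ℝ (Fin 3)), Literature.MathematicalPhysics.StatisticalMechanics.IsHaggSeq s ∧ (∀ v : EuclideanSpace ℝ (Fin 3), ‖F v - (977 / 1000 : ℝ) • v‖ ≤ 977 / 10000 * ‖v‖) ∧ (∀ j k : Q.points, j ≠ k → dist ((Subtype.val : Q.points → EuclideanSpace ℝ (Fin 3)) j) ((Subtype.val : Q.points → EuclideanSpace ℝ (Fin 3)) ⟨x.1, Q.mem_points_of_mem_motif x.2⟩) ≤ 2931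 / 1000 → 977 / 2000 ≤ dist ((Subtype.val : Q.points → EuclideanSpace ℝ (Fin 3)) j) ((Subtype.val : Q.points → EuclideanSpace ℝ (Fin 3)) k)) ∧ (∀ j : Q.points, dist ((Subtype.val : Q.points → EuclideanSpace ℝ (Fin 3)) j) ((Subtype.val : Q.points → EuclideanSpace ℝ (Fin 3)) ⟨x.1, Q.mem_points_of_mem_motif x.2⟩) ≤ 2931 / 1000 → ∃ z ∈ Literature.MathematicalPhysics.StatisticalMechanics.barlowStacking 1 (Real.sqrt (2 / 3)) s, dist ((Subtype.val : Q.points → EuclideanSpace ℝ (Fin 3)) j) (g (F z)) ≤ 977 / 8000) ∧ (∀ z ∈ Literature.MathematicalPhysics.StatisticalMechanics.barlowStacking 1 (Real.sqrt (2 / 3)) s, dist (g (F z)) ((Subtype.val : Q.points → EuclideanSpace ℝ (Fin 3)) ⟨x.1, Q.mem_points_of_mem_motif x.2⟩) ≤ 2931 / 1000 → ∃ j : Q.points, dist ((Subtype.val : Q.points → EuclideanSpace ℝ (Fin 3)) j) (g (F z)) ≤ 977 / 8000)} = Q.motif.card := by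
    rw [Nat.card_congr (Equiv.subtypeUnivEquiv hall), Nat.card_eq_fintype_card,
      Fintype.card_coe]
  rw [hcard] at h1
  have hF : (0 : ℝ) < Q.motif.card := by exact_mod_cast Q.motif_nonempty.card_pos
  by_contra hlt
  push Not at hlt
  have : (Q.motif.card : ℝ) * (Q.energyPerParticle (fun r => min 1 (max 0 (4 - 2 * r)) * lennardJones r) -
      ⨅ Q' : PeriodicConfiguration 3,
        Q'.energyPerParticle (fun r => min 1 (max 0 (4 - 2 * r)) * lennardJones r)) <
      (Q.motif.card : ℝ) * κ :=
    mul_lt_mul_of_pos_left (by linarith) hF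
  linarith

end Summit.AtomisticToContinuum.Crystallization.Theorems.PricedLinkCensusTruncatedCensusGap

end
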